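import Literature.Analysis.FluidPDE.TypeIRateClassicalRepresentative
import HarnessLib

/-!
# The Type-I-in-time mild ancient class: it IS `IsTypeIAncientMild`, and all spatial derivatives are
# bounded near every slice (KNSS 2009, Prop. 4.1 / (4.10))

Analysis/FluidPDE proofs file (theorems only; no definitions, no named facts). The routes of the
Navier–Stokes cells (AxisTwistDoor, PoloidalWindowDoor / `LrcModEntire` cells T1–T2b, ExtremiserTransience)
carry a bounded-in-the-past mild ancient profile as FOUR hypotheses — the Type-I rate in time
`‖v(t,x)‖ ≤ C/√(−t)` (`HasTypeITimeDecay C v`), joint continuity on `(−∞,0) × ℝ³`, the Oseen identity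
`v(t) = e^{(t−s)Δ}v(s) − B¹_s(v,v)(t)` between all negative times, and (weakly) divergence-free slices —
while the tree's regularity API is stated for `IsTypeIAncientMild C v` (jointly `C^∞`, classically
divergence free) and, for derivative bounds, under the SPACE–TIME envelope `HasTypeIDecay`
(`IsTypeIAncientMild.exists_forall_norm_iteratedFDeriv_le_of_hasTypeIDecay`). This file closes the
bookkeeping gap for the time-only class:

* `isTypeIAncientMild_of_hasTypeITimeDecay` — the four hypotheses (weak divergence-freeness)
  imply `IsTypeIAncientMild C v`: joint smoothness is KNSS Prop. 4.1 on bounded time-shifts (the tree's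
  `isSmoothSpaceTimeOn_of_oseenAncient_rate`), classical divergence-freeness of the smooth slices is
  `IsWeaklyDivFree.isDivFree_of_contDiff`;
* `exists_norm_iteratedFDeriv_le_window_of_hasTypeITimeDecay` — **derivative bounds of every order
  near a slice**: for `t < 0` and `k ∈ ℕ` there is `K` with `‖Dᵏv(σ,·)(x)‖ ≤ K` for all
  `σ ∈ (9t/8, 7t/8)` and all `x` — KNSS (4.10) "`‖u‖_{C^k_par(ℝⁿ×(−δ,0))} ≤ C(k,δ,‖u‖_∞)`" for the
  time-shifted field `τ ↦ v(τ + t/2)`, which is bounded by `C/√(−t/2)` on `τ < 0` (the tree's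
  `exists_norm_iteratedFDeriv_le_of_bounded_oseenMild`); `…_slice_…` is the form at the slice itself,
  and `IsTypeIAncientMild.exists_norm_iteratedFDeriv_le_slice` the form on the packaged class.

WHAT THIS IS NOT: no statement about Navier–Stokes regularity; regularity bookkeeping for
hypothetical blow-up profiles (Seregin 2014, Prop. 3.9: "bounded ancient [mild] solutions have bounded
derivatives of all orders on `ℝ³ × (−∞, t₀)`", here slice-wise with a constant depending on the slice).

## References

* G. Koch, N. Nadirashvili, G. Seregin, V. Šverák, *Liouville theorems for the Navier–Stokes
  equations and applications*, Acta Math. 203 (2009) 83–105 = arXiv:0709.3599, §4 (i)–(iii),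
  Prop. 4.1 with (4.6) and (4.10). [KochNadirashviliSereginSverak2009]
* G. Seregin, *Lecture Notes on Regularity Theory for the Navier–Stokes Equations* (2014), §6.3
  Prop. 3.9. [Seregin2014]

## Mathlib / tree search

Tree: `isSmoothSpaceTimeOn_of_oseenAncient_rate` (`TypeIRateClassicalRepresentative`),
`exists_norm_iteratedFDeriv_le_of_bounded_oseenMild`, `contDiffOn_of_bounded_oseenMild`
(`GigaMiura2011ScaledAlignmentBlowupLimitHolds`), `IsWeaklyDivFree.isDivFree_of_contDiff`,
`VectorCalculus.IsDivFree.isWeaklyDivFree_holds`, `oseenDuhamel_translate`, `heatFlow_of_pos`.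
-/

noncomputable section

open MeasureTheory Set Function Filter Metric
open _root_.Topology

namespace Literature.Analysis.FluidPDE

variable {C : ℝ} {v : ℝ → EuclideanSpace ℝ (Fin 3) → EuclideanSpace ℝ (Fin 3)}

/-- The Type-I constant of a field with the Type-I rate is non-negative (read the rate at `(−1, 0)`).
(private helper) [folklore] -/
private theorem nonneg_of_hasTypeITimeDecay (hdec : HasTypeITimeDecay C v) : 0 ≤ C := by
  have h := hdec (-1) (by norm_num) 0
  rw [neg_neg, Real.sqrt_one, div_one] at h
  exact (norm_nonneg _).trans h

/-- **The time-only class is the KNSS-gauge class `IsTypeIAncientMild`.** A field on `(−∞, 0) × ℝ³`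
with the Type-I rate `‖v(t,x)‖ ≤ C/√(−t)`, jointly continuous, Oseen-mild between all pairs of
negative times and with weakly divergence-free slices is jointly `C^∞` (KNSS 2009, Prop. 4.1 /
§4 (iii): "mild bounded solutions … are smooth", on bounded time-shifts), has classically
divergence-free slices, and so satisfies `IsTypeIAncientMild C v`.
[cite: KochNadirashviliSereginSverak2009, Prop. 4.1 and §4 (iii) (arXiv:0709.3599v1 p. 8)] -/
theorem isTypeIAncientMild_of_hasTypeITimeDecay (hdec : HasTypeITimeDecay C v)
    (hcont : ContinuousOn (uncurry v) (Iio (0 : ℝ) ×ˢ univ))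
    (hmild : ∀ s t : ℝ, s < t → t < 0 → ∀ x,
      v t x = UnboundedOperators.heatExtension (v s) (t - s) x - oseenDuhamel 1 s v v t x)
    (hwdiv : ∀ t < 0, IsWeaklyDivFree (v t)) :
    IsTypeIAncientMild C v := by
  have hsm : IsSmoothSpaceTimeOn (Iio 0) v := isSmoothSpaceTimeOn_of_oseenAncient_rate hcont hwdiv hmild hdec
  refine ⟨hsm, fun t ht => ?_, fun s t hst ht x => ?_, hdec⟩
  · have h1 : ContDiff ℝ 1 (v t) := contDiff_infty.1 (hsm.contDiff_slice ht) 1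
    exact (hwdiv t ht).isDivFree_of_contDiff h1
  · rw [heatFlow_of_pos _ (sub_pos.2 hst)]
    exact hmild s t hst ht x

/-- **Derivative bounds of every order near a slice, time-only class** (KNSS 2009, (4.10):
"`‖u‖_{C^k_par} ≤ C(k, ‖u‖_∞)`" on windows): for `t < 0` and `k ∈ ℕ` there is `K` with
`‖Dᵏ v(σ,·)(x)‖ ≤ K` for all `σ ∈ (9t/8, 7t/8)` and all `x ∈ ℝ³`. Proof: the time-shifted field
`τ ↦ v(τ + t/2)` is continuous, Oseen-mild and bounded by `C/√(−t/2)` on `τ < 0`, so the tree's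
`exists_norm_iteratedFDeriv_le_of_bounded_oseenMild` bounds its derivatives on the window
`[5t/8, 3t/8)`, i.e. those of `v` on `[9t/8, 7t/8)`.
[cite: KochNadirashviliSereginSverak2009, §4 Prop. 4.1 with (4.10) (arXiv:0709.3599v1 p. 8)] -/
theorem exists_norm_iteratedFDeriv_le_window_of_hasTypeITimeDecay (hdec : HasTypeITimeDecay C v)
    (hcont : ContinuousOn (uncurry v) (Iio (0 : ℝ) ×ˢ univ))
    (hmild : ∀ s t : ℝ, s < t → t < 0 → ∀ x,
      v t x = UnboundedOperators.heatExtension (v s) (t - s) x - oseenDuhamel 1 s v v t x)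
    (hwdiv : ∀ t < 0, IsWeaklyDivFree (v t)) {t : ℝ} (ht : t < 0) (k : ℕ) :
    ∃ K : ℝ, ∀ σ ∈ Ioo (9 * t / 8) (7 * t / 8), ∀ x, ‖iteratedFDeriv ℝ k (v σ) x‖ ≤ K := by
  have hC0 : 0 ≤ C := nonneg_of_hasTypeITimeDecay hdec
  -- the shifted field `V τ = v (τ + b)`, `b = t/2`, bounded by `M = C/√(-b)` on `τ < 0`
  set b : ℝ := t / 2 with hb
  set M : ℝ := C / Real.sqrt (-b) with hM
  set V : ℝ → EuclideanSpace ℝ (Fin 3) → EuclideanSpace ℝ (Fin 3) := fun τ => v (τ + b) with hV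
  have hVneg : ∀ τ : ℝ, τ < 0 → τ + b < 0 := fun τ hτ => by rw [hb]; linarith
  have hVc : ContinuousOn (uncurry V) (Ioo t 0 ×ˢ univ) := by
    have hmap : Continuous fun q : ℝ × EuclideanSpace ℝ (Fin 3) => (q.1 + b, q.2) :=
      (continuous_fst.add continuous_const).prodMk continuous_snd
    have hinto : MapsTo (fun q : ℝ × EuclideanSpace ℝ (Fin 3) => (q.1 + b, q.2)) (Ioo t 0 ×ˢ univ)
        (Iio (0 : ℝ) ×ˢ univ) := fun q hq => ⟨hVneg q.1 hq.1.2, mem_univ _⟩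
    exact (hcont.comp hmap.continuousOn hinto).congr fun q _ => rfl
  have hVdiv : ∀ τ ∈ Ioo t 0, IsWeaklyDivFree (V τ) := fun τ hτ => hwdiv (τ + b) (hVneg τ hτ.2)
  have hVmild : ∀ s' t' : ℝ, t < s' → s' < t' → t' < 0 → ∀ x,
      V t' x = UnboundedOperators.heatExtension (V s') (t' - s') x - oseenDuhamel 1 s' V V t' x := by
    intro s' t' _ hst ht' x
    have h := hmild (s' + b) (t' + b) (by linarith) (hVneg t' ht') x
    rw [show t' + b - (s' + b) = t' - s' by ring] at h
    rw [show V t' x = v (t' + b) x from rfl, h, oseenDuhamel_translate 1 s' b v v t' x]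
  have hVbd : ∀ τ ∈ Ioo t 0, ∀ x, ‖V τ x‖ ≤ M := by
    intro τ hτ x
    have hτb : τ + b < 0 := hVneg τ hτ.2
    refine (hdec (τ + b) hτb x).trans ?_
    rw [hM]
    exact div_le_div_of_nonneg_left hC0 (Real.sqrt_pos.2 (by rw [hb]; linarith))
      (Real.sqrt_le_sqrt (by linarith [hτ.2]))
  -- KNSS (4.10) on the window `[a + δ, a + ℓ) = [5t/8, 3t/8)`, `a = 3t/4`
  obtain ⟨K, hK⟩ := exists_norm_iteratedFDeriv_le_of_bounded_oseenMild M k (ℓ := -(3 * t) / 8)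
    (δ := -t / 8) (by linarith) (by linarith)
  have hwin := hK (A := t) (a := 3 * t / 4) (u := V) (by linarith) (by linarith) hVc hVdiv hVmild hVbd
  refine ⟨K, fun σ hσ x => ?_⟩
  have hτ : σ - b ∈ Ico (3 * t / 4 + -t / 8) (3 * t / 4 + -(3 * t) / 8) := by
    rw [hb]; constructor <;> [have := hσ.1; have := hσ.2] <;> linarith
  have h := hwin (σ - b) hτ x
  have hslice : V (σ - b) = v σ := by
    funext y; show v (σ - b + b) y = v σ y; rw [sub_add_cancel]
  rwa [hslice] at h

/-- **Derivative bounds of every order AT a slice, time-only class**: for `t < 0` and `k ∈ ℕ` there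
is `K` with `‖Dᵏ v(t,·)(x)‖ ≤ K` for all `x` (KNSS 2009, (4.10); Seregin 2014, Prop. 3.9: bounded mild
ancient solutions have bounded derivatives of all orders).
[cite: KochNadirashviliSereginSverak2009, §4 Prop. 4.1 with (4.10) (arXiv:0709.3599v1 p. 8)] -/
theorem exists_norm_iteratedFDeriv_le_slice_of_hasTypeITimeDecay (hdec : HasTypeITimeDecay C v)
    (hcont : ContinuousOn (uncurry v) (Iio (0 : ℝ) ×ˢ univ))
    (hmild : ∀ s t : ℝ, s < t → t < 0 → ∀ x,
      v t x = UnboundedOperators.heatExtension (v s) (t - s) x - oseenDuhamel 1 s v v t x)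
    (hwdiv : ∀ t < 0, IsWeaklyDivFree (v t)) {t : ℝ} (ht : t < 0) (k : ℕ) :
    ∃ K : ℝ, ∀ x, ‖iteratedFDeriv ℝ k (v t) x‖ ≤ K := by
  obtain ⟨K, hK⟩ := exists_norm_iteratedFDeriv_le_window_of_hasTypeITimeDecay hdec hcont hmild hwdiv ht k
  exact ⟨K, fun x => hK t (by constructor <;> linarith) x⟩

/-- **Derivative bounds of every order at a slice for the packaged class `IsTypeIAncientMild`**
(no space–time envelope needed): for `IsTypeIAncientMild C v`, `t < 0`, `k ∈ ℕ` there is `K` with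
`‖Dᵏ v(t,·)(x)‖ ≤ K` for all `x` — the time-only companion of
`IsTypeIAncientMild.exists_forall_norm_iteratedFDeriv_le_of_hasTypeIDecay` (whose scale-invariant
constant needs `HasTypeIDecay`). [cite: KochNadirashviliSereginSverak2009, §4 Prop. 4.1 with (4.10) (arXiv:0709.3599v1 p. 8)] -/
theorem IsTypeIAncientMild.exists_norm_iteratedFDeriv_le_slice (hv : IsTypeIAncientMild C v) {t : ℝ}
    (ht : t < 0) (k : ℕ) :
    ∃ K : ℝ, ∀ x, ‖iteratedFDeriv ℝ k (v t) x‖ ≤ K := by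
  obtain ⟨hsm, hdiv, hmild, hdec⟩ := hv
  have hmild' : ∀ s t : ℝ, s < t → t < 0 → ∀ x,
      v t x = UnboundedOperators.heatExtension (v s) (t - s) x - oseenDuhamel 1 s v v t x := by
    intro s t' hst ht' x
    rw [← heatFlow_of_pos _ (sub_pos.2 hst)]
    exact hmild s t' hst ht' x
  have hwdiv : ∀ t < 0, IsWeaklyDivFree (v t) := fun t' ht' =>
    VectorCalculus.IsDivFree.isWeaklyDivFree_holds (hdiv t' ht')
      (contDiff_infty.1 (IsSmoothSpaceTimeOn.contDiff_slice (S := Iio 0) hsm ht') 1)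
  exact exists_norm_iteratedFDeriv_le_slice_of_hasTypeITimeDecay hdec (IsSmoothSpaceTimeOn.continuousOn hsm)
    hmild' hwdiv ht k

end Literature.Analysis.FluidPDE

end
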